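import Literature.AlgebraicTopology.SingularHomology.PrismChains
import Literature.AlgebraicTopology.SingularHomology.SimplexBoxExtension
import Mathlib.Algebra.Ring.GeomSum
import HarnessLib

/-!
# Eilenberg compression of singular simplices and the vanishing clause of the Hurewicz theorem

Topic `Literature/AlgebraicTopology/SingularHomology`. The classical chain-level proof
(S. Eilenberg, Singular homology theory, Ann. of Math. 45 (1944); E. Spanier, *Algebraic
Topology* (1966), Ch. 7, Sec. 4; not the CW-approximation proof printed in A. Hatcher,
*Algebraic Topology*, CUP 2002, Thm. 4.32) that the top-dimensional homology of a highly
connected space vanishes: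

**Theorem** (`isZero_singularHomology_of_cubesContractUpTo`). Let `X` be a space, `x₀ ∈ X`,
`m ≥ 1`, and assume that for every `q ≤ m` every map of the cube `I^q` into `X` which is constant
`= x₀` on `∂I^q` is null-homotopic rel `∂I^q` (`Compression.CubesContractUpTo x₀ m`: `X` is
path connected and `π_q(X, x₀) = 0` for `1 ≤ q ≤ m` in Mathlib's cubical model `GenLoop`).
Then `Hₘ(X; R) = 0` for every commutative ring `R`.

Proof (all of it formalised here, on the concrete chains `CChain R X n = (SingularSimplex X n →₀ R)`
of `SingularChainsConcrete.lean` and transported to Mathlib's `singularHomology` at the end):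

1. *Compression* (`Compression.homotopyOf`). By induction on `q ≤ m`, every singular `q`-simplex
   `ρ : Δ^q → X` is given a homotopy `P ρ : Δ^q × [0, 1] → X` from `ρ` to the constant map `x₀`,
   constant `= x₀` from time `τ_{q+1} = 1 - 2^{-(q+2)}` on, and COMPATIBLE WITH FACES:
   `P ρ (δⱼ z, t) = P (ρ ∘ δⱼ) (z, t)` (`Compression.FaceCompat`). The inductive step fills the
   prism `Δ^{q+1} × [0,1]` from its bottom `σ` and its sides — the already constructed homotopies of
   the faces, which glue continuously along `∂Δ^{q+1} × [0,1]` (`Compression.sideOf`, by the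
   codimension-two face identity `StdSimplexFaces.face_face_eq`) — using the box-filling lemma
   `exists_simplex_box_extension` (Hatcher Lemma 4.7, where `π_{q+1}(X, x₀) = 0` enters).
2. *Prisms* (`Compression.prismOp`). `D ρ := (P ρ)♯ (prismChain R q)`, the push-forward of the
   universal prism chain of `PrismChains.lean`; by the prism boundary formula and face
   compatibility, `∂ D σ = κ - σ - D ∂σ` for every `m`-simplex `σ`, `κ` the constant `m`-simplex at
   `x₀` (`Compression.bd_prismOp`).
3. *Conclusion*. For an `m`-cycle `z`, `z = (∑ coefficients of z) • κ - ∂ D z`; the constant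
   simplex `κ` is a boundary for `m` odd and, for `m` even, `∂κ ≠ 0` forces the coefficient sum to
   vanish (`Compression.exists_bd_eq`). Hence `Hₘ(X; R) = 0`.

The hypotheses of Hatcher's Thm. 4.32 (`X` `(n-1)`-connected) give `CubesContractUpTo x₀ (n-1)`;
the derivation of the named fact `hurewicz_isZero` from the theorem here is in
`HurewiczTheoremProofs.lean`. Nothing in this file is asserted; there are no named facts.

## References

* A. Hatcher, *Algebraic Topology*, CUP 2002, §4.2 Thm. 4.32; §4.1 Lemma 4.7; §2.1 Thm. 2.10.
  [HatcherAT2002]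
* E. H. Spanier, *Algebraic Topology*, Springer 1981 (reprint of 1966), Ch. 7, Sec. 4. [Spanier1981]
-/

noncomputable section

open Set CategoryTheory Limits
open Literature.AlgebraicTopology.Homotopy.WhiteheadCW (tau tau_pos tau_lt_one tau_le_one tau_lt_succ)

universe u v

namespace Literature.AlgebraicTopology.SingularHomology

open SingularSimplex

variable {X : Type u} [TopologicalSpace X]

/-! ### Generalities on concrete chain complexes -/

section Generalities

variable {R : Type v} [CommRing R] {M : Type v} [AddCommGroup M] [Module R M]

/-- `∂ ∂ = 0` on concrete singular chains (element form of `d_comp_d`). [folklore] -/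
lemma csingularChainComplex.bd_bd (q : ℕ) (c : CChain M X (q + 2)) :
    csingularChainComplex.bd R q (csingularChainComplex.bd R (q + 1) c) = 0 := by
  rw [← csingularChainComplex.d_apply, ← csingularChainComplex.d_apply, ← ModuleCat.comp_apply,
    HomologicalComplex.d_comp_d]
  rfl

/-- The alternating sum of signs over `Fin (n + 1)`: `∑ⱼ (-1)ʲ = [n even]` (Mathlib's
`neg_one_geom_sum` reindexed). [folklore] -/
lemma sum_neg_one_pow_fin (n : ℕ) :
    ∑ j : Fin (n + 1), ((-1 : R) ^ (j : ℕ)) = if Even (n + 1) then 0 else 1 := by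
  rw [Fin.sum_univ_eq_sum_range (fun i => (-1 : R) ^ i) (n + 1)]
  exact neg_one_geom_sum

/-- Index adapter for complexes of modules: boundaries from `i` and from `i'` agree when `i = i'`
(to pass between `c.prev j` and its value). [folklore] -/
lemma exists_d_apply_eq_iff_of_eq {ι : Type*} {c : ComplexShape ι}
    (K : HomologicalComplex (ModuleCat.{max u v} R) c) {i i' j : ι} (h : i = i') (z : K.X j) :
    (∃ w : K.X i, K.d i j w = z) ↔ ∃ w : K.X i', K.d i' j w = z := by
  subst h
  rfl

/-- Index adapter for complexes of modules: the cycle conditions towards `j` and `j'` agree when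
`j = j'` (to pass between `c.next i` and its value). [folklore] -/
lemma d_apply_eq_zero_iff_of_eq {ι : Type*} {c : ComplexShape ι}
    (K : HomologicalComplex (ModuleCat.{max u v} R) c) {i j j' : ι} (h : j = j') (z : K.X i) :
    K.d i j z = 0 ↔ K.d i j' z = 0 := by
  subst h
  rfl

end Generalities

namespace Compression

/-! ### The hypothesis: cubes up to dimension `m` contract -/

open unitInterval in
/-- The hypothesis of the compression: every map of a cube `I^q → X`, `q ≤ m`, which is constant
`= x₀` on `∂I^q` is homotopic rel `∂I^q` to the constant map (`π_q(X, x₀) = 0` for `1 ≤ q ≤ m`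
in Mathlib's cubical model, and `X` path connected for `q = 0`). [folklore] -/
def CubesContractUpTo (x₀ : X) (m : ℕ) : Prop :=
  ∀ q : ℕ, q ≤ m → ∀ ψ : C(Fin q → I, X), (∀ y ∈ Cube.boundary (Fin q), ψ y = x₀) →
    ψ.HomotopicRel (ContinuousMap.const _ x₀) (Cube.boundary (Fin q))

/-- The hypothesis is monotone in `m`. [folklore] -/
lemma CubesContractUpTo.mono {x₀ : X} {m m' : ℕ} (h : CubesContractUpTo x₀ m) (hm : m' ≤ m) :
    CubesContractUpTo x₀ m' :=
  fun q hq => h q (hq.trans hm)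

/-! ### Filling prisms over simplices -/

variable (x₀ : X)

open Classical in
/-- A filling of the prism `Δ^q × [0, 1]` with bottom `φ` and sides `h`, constant `= x₀` from time
`τ_{q+1}` on, IF one exists (junk `φ ∘ pr₁` otherwise); `simplexFill_spec` says it does under the
hypotheses of `exists_simplex_box_extension`. [folklore] -/
def simplexFill (q : ℕ) (φ : C(StdSimplex q, X)) (h : StdSimplex q × ℝ → X) : StdSimplex q × ℝ → X :=
  if H : ∃ G : StdSimplex q × ℝ → X, ContinuousOn G (univ ×ˢ Icc (0 : ℝ) 1) ∧
      (∀ y, G (y, 0) = φ y) ∧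
      (∀ y ∈ stdBoundary q, ∀ t ∈ Icc (0 : ℝ) 1, G (y, t) = h (y, t)) ∧
      (∀ y, ∀ t ∈ Icc (tau (q + 1)) 1, G (y, t) = x₀)
  then H.choose else fun p => φ p.1

variable {x₀}

/-- Under the hypotheses of the box-filling lemma (sides continuous on `∂Δ^q × [0,1]`, matching the
bottom on the rim, constant `= x₀` from time `τ_q` on, and cubes of dimension `q` contract),
`simplexFill` is a genuine filling. [folklore] -/
lemma simplexFill_spec {m q : ℕ} (hπ : CubesContractUpTo x₀ m) (hq : q ≤ m)
    (φ : C(StdSimplex q, X)) {h : StdSimplex q × ℝ → X}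
    (hh : ContinuousOn h (stdBoundary q ×ˢ Icc (0 : ℝ) 1))
    (h0 : ∀ y ∈ stdBoundary q, h (y, 0) = φ y)
    (hlate : ∀ y ∈ stdBoundary q, ∀ t ∈ Icc (tau q) 1, h (y, t) = x₀) :
    ContinuousOn (simplexFill x₀ q φ h) (univ ×ˢ Icc (0 : ℝ) 1) ∧
      (∀ y, simplexFill x₀ q φ h (y, 0) = φ y) ∧
      (∀ y ∈ stdBoundary q, ∀ t ∈ Icc (0 : ℝ) 1, simplexFill x₀ q φ h (y, t) = h (y, t)) ∧
      (∀ y, ∀ t ∈ Icc (tau (q + 1)) 1, simplexFill x₀ q φ h (y, t) = x₀) := by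
  have H : ∃ G : StdSimplex q × ℝ → X, ContinuousOn G (univ ×ˢ Icc (0 : ℝ) 1) ∧
      (∀ y, G (y, 0) = φ y) ∧
      (∀ y ∈ stdBoundary q, ∀ t ∈ Icc (0 : ℝ) 1, G (y, t) = h (y, t)) ∧
      (∀ y, ∀ t ∈ Icc (tau (q + 1)) 1, G (y, t) = x₀) :=
    exists_simplex_box_extension x₀ (tau_pos q) (tau_lt_succ q) (tau_le_one (q + 1)) (hπ q hq)
      φ.continuous hh h0 hlate
  have hdef : simplexFill x₀ q φ h = H.choose := by
    rw [simplexFill, dif_pos H]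
  rw [hdef]
  exact H.choose_spec

/-! ### Side data assembled from the faces -/

/-- The sides `∂Δ^{q+1} × ℝ → X` of the prism over a `(q+1)`-simplex `σ`, assembled from
homotopies `P` of its faces: at a boundary point `y = δⱼ z` (with `j` the chosen vanishing
coordinate `zeroIdx y`, `z = faceRetr j y`) the value `P (σ.face j) (z, t)`. [folklore] -/
def sideOf {q : ℕ} (P : SingularSimplex X q → StdSimplex q × ℝ → X) (σ : SingularSimplex X (q + 1)) :
    StdSimplex (q + 1) × ℝ → X :=
  fun p => P (σ.face (zeroIdx p.1)) (faceRetr (zeroIdx p.1) p.1, p.2)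

/-- The face formula for the sides over a `1`-simplex (no compatibility needed: a point of `Δ¹`
has at most one vanishing coordinate). [folklore] -/
lemma sideOf_stdFace_zero (P : SingularSimplex X 0 → StdSimplex 0 × ℝ → X)
    (σ : SingularSimplex X 1) (j : Fin 2) (z : StdSimplex 0) (t : ℝ) :
    sideOf P σ (stdFace j z, t) = P (σ.face j) (z, t) := by
  have hj : zeroIdx (stdFace j z) = j :=
    stdSimplex_one_ne (apply_zeroIdx (stdFace_mem_stdBoundary j z)) (stdFace_apply_self j z)
  change P (σ.face (zeroIdx (stdFace j z))) (faceRetr (zeroIdx (stdFace j z)) (stdFace j z), t) = _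
  rw [hj, faceRetr_stdFace]

/-- **The face formula for the sides**: if the homotopies `P` (level `q+1`) and `P'` (level `q`)
are compatible with faces, then the sides assembled from `P` over a `(q+2)`-simplex restrict on
the `j`-th face to `P (σ.face j)` — independently of the chosen vanishing coordinate, by the
codimension-two face identity. [folklore] -/
lemma sideOf_stdFace_succ {q : ℕ} (P : SingularSimplex X (q + 1) → StdSimplex (q + 1) × ℝ → X)
    (P' : SingularSimplex X q → StdSimplex q × ℝ → X)
    (hc : ∀ (ρ : SingularSimplex X (q + 1)) (i : Fin (q + 2)) (w : StdSimplex q) (t : ℝ),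
      t ∈ Icc (0 : ℝ) 1 → P ρ (stdFace i w, t) = P' (ρ.face i) (w, t))
    (σ : SingularSimplex X (q + 2)) (j : Fin (q + 3)) (z : StdSimplex (q + 1)) {t : ℝ}
    (ht : t ∈ Icc (0 : ℝ) 1) :
    sideOf P σ (stdFace j z, t) = P (σ.face j) (z, t) := by
  set y := stdFace j z with hy
  set j' := zeroIdx y with hj'
  have hyj' : (y : Fin (q + 3) → ℝ) j' = 0 := apply_zeroIdx (stdFace_mem_stdBoundary j z)
  change P (σ.face j') (faceRetr j' y, t) = P (σ.face j) (z, t)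
  by_cases hjj : j' = j
  · rw [hjj, hy, faceRetr_stdFace]
  · -- `y` lies on the two faces `j ≠ j'`: go down to the codimension-two face
    obtain ⟨l, hl⟩ := Fin.exists_succAbove_eq hjj
    obtain ⟨l', hl'⟩ := Fin.exists_succAbove_eq (Ne.symm hjj)
    have hzl : (z : Fin (q + 2) → ℝ) l = 0 := by
      rw [← stdFace_apply_succAbove j z l, hl]; exact hyj'
    obtain ⟨w, hw⟩ := exists_stdFace_eq l z hzl
    obtain ⟨z'', hz''⟩ := exists_stdFace_eq j' y hyj'
    have hz' : faceRetr j' y = z'' := by rw [← hz'', faceRetr_stdFace]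
    have hyz' : stdFace j' (faceRetr j' y) = y := by rw [hz', hz'']
    have hz'l' : (faceRetr j' y : Fin (q + 2) → ℝ) l' = 0 := by
      rw [← stdFace_apply_succAbove j' (faceRetr j' y) l', hyz', hl', hy, stdFace_apply_self]
    obtain ⟨w', hw'⟩ := exists_stdFace_eq l' (faceRetr j' y) hz'l'
    have hyy : stdFace j (stdFace l w) = stdFace j' (stdFace l' w') := by
      rw [hw, hw', hyz']
    have hww : w = w' := eq_of_stdFace_stdFace_eq hl hl' hyy
    rw [← hw', hc _ _ _ _ ht, ← face_face_eq σ hl hl', ← hww, ← hc _ _ _ _ ht, hw]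

/-- The sides are continuous on `∂Δ^{q+1} × [0, 1]` when the face formula holds and the face
homotopies are continuous on `Δ^q × [0, 1]` (pasting over the finitely many closed faces).
[folklore] -/
lemma sideOf_continuousOn {q : ℕ} (P : SingularSimplex X q → StdSimplex q × ℝ → X)
    (hcont : ∀ ρ, ContinuousOn (P ρ) (univ ×ˢ Icc (0 : ℝ) 1)) (σ : SingularSimplex X (q + 1))
    (hSF : ∀ (j : Fin (q + 2)) (z : StdSimplex q) (t : ℝ), t ∈ Icc (0 : ℝ) 1 →
      sideOf P σ (stdFace j z, t) = P (σ.face j) (z, t)) :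
    ContinuousOn (sideOf P σ) (stdBoundary (q + 1) ×ˢ Icc (0 : ℝ) 1) := by
  rw [stdBoundary_eq_iUnion_range, iUnion_prod_const]
  refine LocallyFinite.continuousOn_iUnion (locallyFinite_of_finite _)
    (fun j => (isClosed_range_stdFace j).prod isClosed_Icc) fun j => ?_
  have hg : ContinuousOn (fun p : StdSimplex (q + 1) × ℝ => P (σ.face j) (faceRetr j p.1, p.2))
      (Set.range (stdFace j) ×ˢ Icc (0 : ℝ) 1) :=
    (hcont (σ.face j)).comp
      (((faceRetr j).continuous.comp continuous_fst).prodMk continuous_snd).continuousOn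
      fun p hp => ⟨mem_univ _, hp.2⟩
  refine hg.congr ?_
  rintro ⟨y, t⟩ ⟨⟨z, rfl⟩, ht⟩
  change sideOf P σ (stdFace j z, t) = P (σ.face j) (faceRetr j (stdFace j z), t)
  rw [hSF j z t ht, faceRetr_stdFace]

/-- The sides match the bottom `σ` on the rim `∂Δ^{q+1} × {0}` when the face homotopies start at
the faces. [folklore] -/
lemma sideOf_bottom {q : ℕ} (P : SingularSimplex X q → StdSimplex q × ℝ → X)
    (hbot : ∀ ρ y, P ρ (y, 0) = toContinuousMap ρ y) (σ : SingularSimplex X (q + 1))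
    (hSF : ∀ (j : Fin (q + 2)) (z : StdSimplex q) (t : ℝ), t ∈ Icc (0 : ℝ) 1 →
      sideOf P σ (stdFace j z, t) = P (σ.face j) (z, t))
    (y : StdSimplex (q + 1)) (hy : y ∈ stdBoundary (q + 1)) :
    sideOf P σ (y, 0) = toContinuousMap σ y := by
  obtain ⟨j, hj⟩ := hy
  obtain ⟨z, rfl⟩ := exists_stdFace_eq j y hj
  rw [hSF j z 0 ⟨le_rfl, zero_le_one⟩, hbot, toContinuousMap_face_apply]

/-- The sides are constant `= x₀` from time `τ_{q+1}` on when the face homotopies are. [folklore] -/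
lemma sideOf_late {q : ℕ} (P : SingularSimplex X q → StdSimplex q × ℝ → X)
    (hlate : ∀ ρ y, ∀ t ∈ Icc (tau (q + 1)) 1, P ρ (y, t) = x₀) (σ : SingularSimplex X (q + 1))
    (hSF : ∀ (j : Fin (q + 2)) (z : StdSimplex q) (t : ℝ), t ∈ Icc (0 : ℝ) 1 →
      sideOf P σ (stdFace j z, t) = P (σ.face j) (z, t))
    (y : StdSimplex (q + 1)) (hy : y ∈ stdBoundary (q + 1)) (t : ℝ) (ht : t ∈ Icc (tau (q + 1)) 1) :
    sideOf P σ (y, t) = x₀ := by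
  obtain ⟨j, hj⟩ := hy
  obtain ⟨z, rfl⟩ := exists_stdFace_eq j y hj
  rw [hSF j z t ⟨(tau_pos (q + 1)).le.trans ht.1, ht.2⟩, hlate _ _ t ht]

/-! ### The tower of compatible homotopies -/

variable (x₀)

/-- **The compression homotopies.** For every singular `q`-simplex `ρ` of `X`, a map
`Δ^q × ℝ → X` (meaningful on `Δ^q × [0, 1]`): for `q = 0` a filling of `Δ⁰ × [0,1]` starting at
the point `ρ` (a path to `x₀`), and for `q + 1` a filling of the prism over `σ` with bottom `σ`
and sides the homotopies of the faces. Under `CubesContractUpTo x₀ m` these are, for `q ≤ m`,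
homotopies from `ρ` to the constant map, compatible with faces (`levelGood`, `faceCompat`);
Eilenberg 1944 / Spanier 1966, Ch. 7 Sec. 4 (the deformation of the singular complex into the
subcomplex of simplices with skeleton at the base point). [folklore] -/
def homotopyOf : (q : ℕ) → SingularSimplex X q → StdSimplex q × ℝ → X
  | 0 => fun ρ => simplexFill x₀ 0 (toContinuousMap ρ) (fun _ => x₀)
  | q + 1 => fun σ => simplexFill x₀ (q + 1) (toContinuousMap σ) (sideOf (homotopyOf q) σ)

/-- The properties of level `q` of the tower: continuity on `Δ^q × [0,1]`, start at the simplex,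
constant `= x₀` from time `τ_{q+1}` on. [folklore] -/
structure LevelGood (q : ℕ) : Prop where
  /-- continuity on the prism -/
  cont : ∀ ρ : SingularSimplex X q, ContinuousOn (homotopyOf x₀ q ρ) (univ ×ˢ Icc (0 : ℝ) 1)
  /-- the homotopy starts at the simplex -/
  bottom : ∀ (ρ : SingularSimplex X q) (y : StdSimplex q), homotopyOf x₀ q ρ (y, 0) = toContinuousMap ρ y
  /-- the homotopy is constant `= x₀` from time `τ_{q+1}` on -/
  late : ∀ (ρ : SingularSimplex X q) (y : StdSimplex q), ∀ t ∈ Icc (tau (q + 1)) 1,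
    homotopyOf x₀ q ρ (y, t) = x₀

/-- Compatibility of levels `q + 1` and `q` with the faces: `P σ (δⱼ z, t) = P (σ ∘ δⱼ) (z, t)`
on `[0, 1]`. [folklore] -/
def FaceCompat (q : ℕ) : Prop :=
  ∀ (σ : SingularSimplex X (q + 1)) (j : Fin (q + 2)) (z : StdSimplex q) (t : ℝ), t ∈ Icc (0 : ℝ) 1 →
    homotopyOf x₀ (q + 1) σ (stdFace j z, t) = homotopyOf x₀ q (σ.face j) (z, t)

variable {x₀}

/-- Level `0` is good: the box filling over the point `Δ⁰` (a path from `ρ` to `x₀`) exists as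
soon as cubes of dimension `0` contract, i.e. `X` is path connected to `x₀`. [folklore] -/
lemma levelGood_zero {m : ℕ} (hπ : CubesContractUpTo x₀ m) : LevelGood x₀ 0 := by
  have h : ∀ ρ : SingularSimplex X 0, _ := fun ρ =>
    simplexFill_spec hπ (Nat.zero_le m) (toContinuousMap ρ) (h := fun _ => x₀) continuousOn_const
      (fun y hy => by rw [stdBoundary_zero] at hy; exact hy.elim)
      (fun y hy => by rw [stdBoundary_zero] at hy; exact hy.elim)
  exact ⟨fun ρ => (h ρ).1, fun ρ => (h ρ).2.1, fun ρ => (h ρ).2.2.2⟩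

/-- The face formula for the sides at level `q`, from face compatibility one level down (vacuous
for `q = 0`). [folklore] -/
lemma sideOf_stdFace {q : ℕ} (hfc : ∀ q', q = q' + 1 → FaceCompat x₀ q')
    (σ : SingularSimplex X (q + 1)) (j : Fin (q + 2)) (z : StdSimplex q) (t : ℝ)
    (ht : t ∈ Icc (0 : ℝ) 1) :
    sideOf (homotopyOf x₀ q) σ (stdFace j z, t) = homotopyOf x₀ q (σ.face j) (z, t) := by
  cases q with
  | zero => exact sideOf_stdFace_zero _ σ j z t
  | succ q' => exact sideOf_stdFace_succ _ _ (hfc q' rfl) σ j z ht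

/-- **The inductive step**: if level `q` is good and compatible with level `q - 1`, and cubes of
dimension `q + 1` contract, then level `q + 1` is good and compatible with level `q`. [folklore] -/
lemma levelGood_succ {m q : ℕ} (hπ : CubesContractUpTo x₀ m) (hq : q + 1 ≤ m)
    (hg : LevelGood x₀ q) (hfc : ∀ q', q = q' + 1 → FaceCompat x₀ q') :
    LevelGood x₀ (q + 1) ∧ FaceCompat x₀ q := by
  have hSF := sideOf_stdFace hfc
  have h : ∀ σ : SingularSimplex X (q + 1), _ := fun σ =>
    simplexFill_spec hπ hq (toContinuousMap σ) (h := sideOf (homotopyOf x₀ q) σ)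
      (sideOf_continuousOn _ hg.cont σ (hSF σ)) (sideOf_bottom _ hg.bottom σ (hSF σ))
      (sideOf_late _ hg.late σ (hSF σ))
  refine ⟨⟨fun σ => (h σ).1, fun σ => (h σ).2.1, fun σ => (h σ).2.2.2⟩, ?_⟩
  intro σ j z t ht
  change simplexFill x₀ (q + 1) (toContinuousMap σ) (sideOf (homotopyOf x₀ q) σ) (stdFace j z, t) = _
  rw [(h σ).2.2.1 _ (stdFace_mem_stdBoundary j z) t ht, hSF σ j z t ht]

/-- **All levels up to `m` are good and compatible with faces**, GIVEN `CubesContractUpTo x₀ m`.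
[folklore] -/
lemma levelGood_and_faceCompat {m : ℕ} (hπ : CubesContractUpTo x₀ m) :
    ∀ q : ℕ, q ≤ m → LevelGood x₀ q ∧ ∀ q', q = q' + 1 → FaceCompat x₀ q' := by
  intro q
  induction q with
  | zero => exact fun _ => ⟨levelGood_zero hπ, fun q' h => absurd h (Nat.zero_ne_add_one q')⟩
  | succ q ih =>
    intro hq
    obtain ⟨hg, hfc⟩ := ih ((Nat.le_succ q).trans hq)
    obtain ⟨hg', hfc'⟩ := levelGood_succ hπ hq hg hfc
    refine ⟨hg', fun q' h => ?_⟩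
    obtain rfl : q = q' := Nat.succ_injective h
    exact hfc'

/-- Levels `q ≤ m` are good. [folklore] -/
lemma levelGood {m q : ℕ} (hπ : CubesContractUpTo x₀ m) (hq : q ≤ m) : LevelGood x₀ q :=
  (levelGood_and_faceCompat hπ q hq).1

/-- Consecutive levels below `m` are compatible with the faces. [folklore] -/
lemma faceCompat {m q : ℕ} (hπ : CubesContractUpTo x₀ m) (hq : q + 1 ≤ m) : FaceCompat x₀ q :=
  (levelGood_and_faceCompat hπ (q + 1) hq).2 q rfl

/-! ### The compression homotopies as maps of the cylinders -/

/-- The compression homotopy of `ρ` as a continuous map `Δ^q × I → X` on the cylinder of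
`PrismChains.lean`. [folklore] -/
def cylHomotopy {m q : ℕ} (hπ : CubesContractUpTo x₀ m) (hq : q ≤ m) (ρ : SingularSimplex X q) :
    C(Cyl.{u} q, X) where
  toFun p := homotopyOf x₀ q ρ (p.down.1, (p.down.2 : ℝ))
  continuous_toFun :=
    ((levelGood hπ hq).cont ρ).comp_continuous
      ((continuous_fst.comp continuous_uliftDown).prodMk
        (continuous_subtype_val.comp (continuous_snd.comp continuous_uliftDown)))
      fun p => ⟨mem_univ _, p.down.2.2⟩

/-- Pointwise formula for `cylHomotopy`. [folklore] -/
@[simp]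
lemma cylHomotopy_apply {m q : ℕ} (hπ : CubesContractUpTo x₀ m) (hq : q ≤ m) (ρ : SingularSimplex X q)
    (y : StdSimplex q) (t : unitInterval) :
    cylHomotopy hπ hq ρ ⟨(y, t)⟩ = homotopyOf x₀ q ρ (y, (t : ℝ)) := rfl

variable (x₀) in
/-- The constant singular `q`-simplex at `x₀`. [folklore] -/
def constSimplex (q : ℕ) : SingularSimplex X q := ofMap (ContinuousMap.const _ x₀)

/-- Faces of constant simplices are constant. [folklore] -/
@[simp]
lemma constSimplex_face (q : ℕ) (j : Fin (q + 2)) : (constSimplex x₀ (q + 1)).face j = constSimplex x₀ q := by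
  rw [constSimplex, ofMap_face]
  rfl

/-- The compression homotopy starts at the simplex: `ι₀♯ = ρ`. [folklore] -/
lemma botSimplex_map_cylHomotopy {m q : ℕ} (hπ : CubesContractUpTo x₀ m) (hq : q ≤ m)
    (ρ : SingularSimplex X q) : (botSimplex q).map (cylHomotopy hπ hq ρ) = ρ := by
  rw [botSimplex, ofMap_map]
  conv_rhs => rw [← ofMap_toContinuousMap ρ]
  congr 1
  ext y
  exact (levelGood hπ hq).bottom ρ y

/-- The compression homotopy ends at the constant simplex: `ι₁♯ = κ`. [folklore] -/
lemma topSimplex_map_cylHomotopy {m q : ℕ} (hπ : CubesContractUpTo x₀ m) (hq : q ≤ m)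
    (ρ : SingularSimplex X q) : (topSimplex q).map (cylHomotopy hπ hq ρ) = constSimplex x₀ q := by
  rw [topSimplex, ofMap_map, constSimplex]
  congr 1
  ext y
  exact (levelGood hπ hq).late ρ y 1 ⟨tau_le_one _, le_rfl⟩

/-- **Face compatibility on the cylinders**: `P σ ∘ (δⱼ × 1) = P (σ.face j)`. [folklore] -/
lemma cylHomotopy_comp_cylFace {m q : ℕ} (hπ : CubesContractUpTo x₀ m) (hq : q + 1 ≤ m)
    (σ : SingularSimplex X (q + 1)) (j : Fin (q + 2)) :
    (cylHomotopy hπ hq σ).comp (cylFace q j) =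
      cylHomotopy hπ ((Nat.le_succ q).trans hq) (σ.face j) := by
  ext p
  rcases p with ⟨z, t⟩
  exact faceCompat hπ hq σ j z t t.2

/-! ### The prism operators and their boundary -/

variable (R : Type v) [CommRing R]

/-- **The prism operator** `D : C_q(X; R) → C_{q+1}(X; R)`, `σ ↦ (P σ)♯ (prismChain R q)`: the
prism chain of the compression homotopy of each simplex (Hatcher 2002, proof of Thm. 2.10, for
the non-natural homotopies `P σ`). [folklore] -/
def prismOp {m : ℕ} (hπ : CubesContractUpTo x₀ m) (q : ℕ) (hq : q ≤ m) :
    CChain R X q →ₗ[R] CChain R X (q + 1) :=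
  Finsupp.lsum R fun ρ => LinearMap.toSpanSingleton R _
    (chainPush R (cylHomotopy hπ hq ρ) (q + 1) (prismChain R q))

variable {R}

/-- The prism operator on an elementary chain. [folklore] -/
@[simp]
lemma prismOp_single {m : ℕ} (hπ : CubesContractUpTo x₀ m) {q : ℕ} (hq : q ≤ m)
    (ρ : SingularSimplex X q) (r : R) :
    prismOp R hπ q hq (Finsupp.single ρ r) = r • chainPush R (cylHomotopy hπ hq ρ) (q + 1) (prismChain R q) := by
  simp [prismOp]

variable (R) in
/-- The sum of the coefficients of a chain (the augmentation, in every degree). [folklore] -/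
def coeffSum (q : ℕ) : CChain R X q →ₗ[R] R := Finsupp.lsum R fun _ => LinearMap.id

/-- The coefficient sum of an elementary chain. [folklore] -/
@[simp]
lemma coeffSum_single {q : ℕ} (ρ : SingularSimplex X q) (r : R) : coeffSum R q (Finsupp.single ρ r) = r := by
  simp [coeffSum]

/-- **The prism boundary formula for the compression**, on an elementary chain:
`∂ D σ = κ - σ - D ∂σ` for a `(q+1)`-simplex `σ`, `q + 1 ≤ m`. [folklore] -/
lemma bd_prismOp_single {m q : ℕ} (hπ : CubesContractUpTo x₀ m) (hq : q + 1 ≤ m)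
    (σ : SingularSimplex X (q + 1)) (r : R) :
    csingularChainComplex.bd R (q + 1) (prismOp R hπ (q + 1) hq (Finsupp.single σ r)) =
      Finsupp.single (constSimplex x₀ (q + 1)) r - Finsupp.single σ r -
        prismOp R hπ q ((Nat.le_succ q).trans hq) (csingularChainComplex.bd R q (Finsupp.single σ r)) := by
  rw [prismOp_single, map_smul, bd_chainPush, bd_prismChain_succ', map_sub, map_sub, chainPush_single,
    chainPush_single, topSimplex_map_cylHomotopy, botSimplex_map_cylHomotopy, map_sum,
    csingularChainComplex.bd_single, map_sum]
  simp only [map_smul, prismOp_single, ← chainPush_comp, cylHomotopy_comp_cylFace, smul_sub,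
    Finset.smul_sum, Finsupp.smul_single, smul_eq_mul, mul_one]
  congr 1
  refine Finset.sum_congr rfl fun j _ => ?_
  rw [smul_smul, mul_comm]

/-- **The prism boundary formula for the compression**: `∂ D c = (∑ coefficients of c) • κ - c - D ∂c`
on `C_{q+1}(X; R)`, `q + 1 ≤ m`. [folklore] -/
theorem bd_prismOp {m q : ℕ} (hπ : CubesContractUpTo x₀ m) (hq : q + 1 ≤ m) (c : CChain R X (q + 1)) :
    csingularChainComplex.bd R (q + 1) (prismOp R hπ (q + 1) hq c) =
      Finsupp.single (constSimplex x₀ (q + 1)) (coeffSum R (q + 1) c) - c -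
        prismOp R hπ q ((Nat.le_succ q).trans hq) (csingularChainComplex.bd R q c) := by
  have h : (csingularChainComplex.bd R (q + 1)) ∘ₗ (prismOp R hπ (q + 1) hq) =
      (Finsupp.lsingle (constSimplex x₀ (q + 1))) ∘ₗ (coeffSum R (q + 1)) - LinearMap.id -
        (prismOp R hπ q ((Nat.le_succ q).trans hq)) ∘ₗ (csingularChainComplex.bd R q) := by
    refine Finsupp.lhom_ext fun σ r => ?_
    simp only [LinearMap.comp_apply, LinearMap.sub_apply, LinearMap.id_apply, Finsupp.lsingle_apply,
      coeffSum_single]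
    exact bd_prismOp_single hπ hq σ r
  exact LinearMap.congr_fun h c

/-! ### Cycles are boundaries -/

/-- The boundary of a constant simplex: `∂ κ_{q+1} = (∑ⱼ (-1)ʲ) κ_q`. [folklore] -/
lemma bd_single_constSimplex (q : ℕ) (r : R) :
    csingularChainComplex.bd R q (Finsupp.single (constSimplex x₀ (q + 1)) r) =
      (if Even (q + 2) then (0 : R) else 1) • Finsupp.single (constSimplex x₀ q) r := by
  rw [csingularChainComplex.bd_single]
  simp only [constSimplex_face]
  rw [← Finset.sum_smul, sum_neg_one_pow_fin]

/-- **Every `m`-cycle is a boundary** (`m = q + 1 ≥ 1`), GIVEN `CubesContractUpTo x₀ (q + 1)`: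
`z = s • κ - ∂ D z` with `s` the coefficient sum; for `m` odd `κ = ∂ κ'`, for `m` even
`0 = ∂ z = s • κ_{m-1}` forces `s = 0`. [folklore] -/
theorem exists_bd_eq {q : ℕ} (hπ : CubesContractUpTo x₀ (q + 1)) (z : CChain R X (q + 1))
    (hz : csingularChainComplex.bd R q z = 0) :
    ∃ w : CChain R X (q + 2), csingularChainComplex.bd R (q + 1) w = z := by
  have key := bd_prismOp (R := R) hπ le_rfl z
  rw [hz, map_zero, sub_zero] at key
  set s := coeffSum R (q + 1) z with hs
  set D := prismOp R hπ (q + 1) le_rfl with hD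
  rcases Nat.even_or_odd q with hq | hq
  · -- `m = q + 1` odd: the constant simplex is a boundary
    refine ⟨Finsupp.single (constSimplex x₀ (q + 2)) s - D z, ?_⟩
    have he : ¬ Even (q + 1 + 2) := by
      rw [Nat.even_add_one, Nat.even_add_one, not_not, Nat.even_add_one, not_not]; exact hq
    rw [map_sub, bd_single_constSimplex, if_neg he, one_smul, key, sub_sub_cancel]
  · -- `m = q + 1` even: the coefficient sum vanishes
    have hbz := congrArg (csingularChainComplex.bd R q) key
    rw [csingularChainComplex.bd_bd, map_sub, hz, sub_zero, bd_single_constSimplex] at hbz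
    have he : ¬ Even (q + 2) := by
      rw [Nat.even_add_one, Nat.even_add_one, not_not]; exact Nat.not_even_iff_odd.mpr hq
    rw [if_neg he, one_smul] at hbz
    have hs0 : s = 0 := by
      have := Finsupp.single_eq_zero.mp hbz.symm
      exact this
    rw [hs0, Finsupp.single_zero, zero_sub] at key
    refine ⟨-D z, ?_⟩
    rw [map_neg, key, neg_neg]

/-- **The top homology of a space whose cubes contract up to dimension `m ≥ 1` vanishes**
(concrete chains): `H_{q+1}(X; R) = 0` GIVEN `CubesContractUpTo x₀ (q + 1)`. [folklore] -/
theorem isZero_csingularHomology {q : ℕ} (hπ : CubesContractUpTo x₀ (q + 1)) :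
    IsZero (csingularHomology R R X (q + 1)) := by
  rw [isZero_homology_iff]
  intro z hz
  rw [d_apply_eq_zero_iff_of_eq _ (ChainComplex.next_nat_succ q),
    csingularChainComplex.d_apply] at hz
  rw [exists_d_apply_eq_iff_of_eq _ (ChainComplex.prev ℕ (q + 1))]
  obtain ⟨w, hw⟩ := exists_bd_eq hπ z hz
  exact ⟨w, by rw [csingularChainComplex.d_apply]; exact hw⟩

end Compression

/-- **Vanishing of the top homology of a highly connected space** (the vanishing clause of the
Hurewicz theorem in its classical chain-level form; Eilenberg 1944, Spanier 1966 Ch. 7 Sec. 4;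
cf. Hatcher 2002, Thm. 4.32): if every map of a cube `I^q → X`, `q ≤ m + 1`, constant `= x₀` on
`∂I^q` is null-homotopic rel `∂I^q` (`X` path connected, `π_q(X, x₀) = 0` for `1 ≤ q ≤ m + 1`),
then `H_{m+1}(X; R) = 0` for Mathlib's singular homology with coefficients in any commutative ring
`R`. [folklore] -/
theorem isZero_singularHomology_of_cubesContractUpTo {x₀ : X} {m : ℕ}
    (hπ : Compression.CubesContractUpTo x₀ (m + 1)) (R : Type v) [CommRing R] :
    IsZero (singularHomology R R X (m + 1)) :=
  (Compression.isZero_csingularHomology (R := R) hπ).of_iso (csingularHomology.compIso R R X (m + 1)).symm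

end Literature.AlgebraicTopology.SingularHomology
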